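import Summits.QuantumFields.YangMills.Theses.OnsetTautology
import Mathlib
import HarnessLib

/-!
# Route `OnsetTautology` (ym-idea-11 g12 LINE 2 «cubic anchor»): the support `AdmissibleAtomProfile`
# (stmt-QuantumFields-23903), PROVED BY NAME

An admissible atom profile exists: a Schwartz function `b` on `ℝ⁴` with compact support inside `{u₀ > 0}`, `∫ b ≠ 0`, invariant under
the coordinate permutations and under the time reflection `u₀ ↦ t − u₀` for some `t` (here `t = 2`).  Construction (the planner's):
`b(u) := φ(‖u − (1,1,1,1)‖²)` with `φ` a `ContDiffBump` at `0 ∈ ℝ` of radii `1/4 < 1/2`; it is smooth with support in the unit ball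
around `(1,1,1,1)` — so inside `{u₀ > 0}` —, non-negative with `b(1,1,1,1) = 1` (positive integral), and `‖u − (1,1,1,1)‖²` is invariant
under coordinate permutations and under `u₀ ↦ 2 − u₀`.  Pure Mathlib.  Width seat `ym-line-sfw-p2-w4` g19 (cell ym-idea-1; free
hands), `--workitem stmt-QuantumFields-23903`.  HONEST FRAMING: a bump function exists — nothing about the cruxes of the line
(`SlabCubicFloors`, `CubicAnchoredAtomBound`), the leaf or the Yang–Mills mass gap is proved. [folklore]
-/

set_option autoImplicit false

namespace Summit.QuantumFields.YangMills.Theorems.OnsetTautology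

open MeasureTheory

/-- **`OnsetTautology.AdmissibleAtomProfile`** (stmt-QuantumFields-23903), BY NAME: the radial bump `φ(‖u − (1,1,1,1)‖²)`.
[folklore] -/
theorem admissibleAtomProfile_proof : Summit.QuantumFields.YangMills.Theses.OnsetTautology.AdmissibleAtomProfile := by
  -- the centre `p = (1,1,1,1)` and the radial profile
  let p : EuclideanSpace ℝ (Fin 4) := WithLp.toLp 2 (fun _ : Fin 4 => (1 : ℝ))
  have hp : ∀ i : Fin 4, p i = 1 := fun i => rfl
  let φ : ContDiffBump (0 : ℝ) := ⟨1 / 4, 1 / 2, by norm_num, by norm_num⟩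
  have hφout : φ.rOut = 1 / 2 := rfl
  have hφin : φ.rIn = 1 / 4 := rfl
  let f : EuclideanSpace ℝ (Fin 4) → ℝ := fun u => φ (‖u - p‖ ^ 2)
  have hf_smooth : ContDiff ℝ (⊤ : ℕ∞) f :=
    φ.contDiff.comp ((contDiff_norm_sq ℝ).comp (contDiff_id.sub contDiff_const))
  have hf_cont : Continuous f := hf_smooth.continuous
  have hf_zero : ∀ u : EuclideanSpace ℝ (Fin 4), 1 / 2 ≤ ‖u - p‖ ^ 2 → f u = 0 := by
    intro u hu
    refine φ.zero_of_le_dist ?_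
    rw [hφout, Real.dist_eq, sub_zero, abs_of_nonneg (sq_nonneg _)]
    exact hu
  have hf_cpt : HasCompactSupport f := by
    refine HasCompactSupport.intro (isCompact_closedBall p 1) fun u hu => hf_zero u ?_
    rw [Metric.mem_closedBall, not_le, dist_eq_norm] at hu
    nlinarith
  -- coordinates are bounded by the norm
  have habs : ∀ (y : EuclideanSpace ℝ (Fin 4)) (i : Fin 4), |y i| ≤ ‖y‖ := by
    intro y i
    rw [EuclideanSpace.norm_eq, ← Real.sqrt_sq_eq_abs]
    refine Real.sqrt_le_sqrt ?_
    have := Finset.single_le_sum (f := fun k : Fin 4 => ‖y k‖ ^ 2) (fun k _ => sq_nonneg _) (Finset.mem_univ i)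
    simpa using this
  -- the Schwartz function
  refine ⟨hf_cpt.toSchwartzMap hf_smooth, hf_cpt, ?_, ?_, ?_, ⟨2, ?_⟩⟩
  · -- support inside `{u₀ > 0}`
    intro u hu
    have hsub : tsupport f ⊆ {u : EuclideanSpace ℝ (Fin 4) | ‖u - p‖ ^ 2 ≤ 1 / 2} :=
      closure_minimal (fun u hu => by
        by_contra h
        simp only [Set.mem_setOf_eq, not_le] at h
        exact hu (hf_zero u h.le)) (isClosed_le (by fun_prop) continuous_const)
    have h1 : ‖u - p‖ ^ 2 ≤ 1 / 2 := hsub hu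
    have h2 : ‖u - p‖ < 1 := by nlinarith [norm_nonneg (u - p)]
    have h3 : |(u - p) 0| ≤ ‖u - p‖ := habs (u - p) 0
    have h4 : (u - p) 0 = u 0 - 1 := by simp [hp]
    rw [h4] at h3
    show 0 < u 0
    linarith [(abs_lt.1 (h3.trans_lt h2)).1]
  · -- non-zero integral: `f ≥ 0`, continuous, compactly supported, `f p = 1`
    have hfp : f p ≠ 0 := by
      show φ (‖p - p‖ ^ 2) ≠ 0
      rw [sub_self, norm_zero, sq, mul_zero, φ.one_of_mem_closedBall (by simp [hφin])]
      exact one_ne_zero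
    exact (hf_cont.integral_pos_of_hasCompactSupport_nonneg_nonzero hf_cpt (fun u => φ.nonneg) hfp).ne'
  · -- coordinate permutations preserve `‖u − p‖`
    intro π u
    show φ (‖(WithLp.toLp 2 fun i => u (π i)) - p‖ ^ 2) = φ (‖u - p‖ ^ 2)
    congr 2
    rw [EuclideanSpace.norm_eq, EuclideanSpace.norm_eq]
    congr 1
    exact Fintype.sum_equiv π _ _ (fun i => by simp [hp])
  · -- the time reflection `u₀ ↦ 2 − u₀` preserves `‖u − p‖`
    intro u
    show φ (‖(WithLp.toLp 2 fun i => if i = 0 then 2 - u i else u i) - p‖ ^ 2) = φ (‖u - p‖ ^ 2)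
    congr 2
    rw [EuclideanSpace.norm_eq, EuclideanSpace.norm_eq]
    congr 1
    refine Finset.sum_congr rfl fun i _ => ?_
    by_cases hi : i = 0
    · subst hi
      simp only [PiLp.sub_apply, if_true, hp, Real.norm_eq_abs, sq_abs]
      ring
    · simp [hi, hp]

end Summit.QuantumFields.YangMills.Theorems.OnsetTautology
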